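/-
Copyright (c) 2026 the pub-hodgecm-mathlib formalisation cell (harness21).  Prover seat hodgecm-mathlib-F0P2-p11 (g2) (L1; LEAD F0P6-plan (g14) «(o1) KIND 1», memo
`CENSUS-K1-DealTable` ADDENDUM 2 — the norm-reading step), Track B «K2-LIT» ∕ hLiu418 #184♮, ROAD Φ, G5-b: A `σ`-INVARIANT ADELE IS THE BASE CHANGE OF ITS REAL PART,
so a norm-rescaled corner coordinate `x · (t⊗1)δ` (`σ x = x`) is again on the corner line: `= ((re x · t)⊗1)·δ`.  THEOREMS ONLY.
-/
import Summits.HodgeConjecture.HodgeConjecture.Theorems.K2LiuUnipDeltaCornerCoordinates   -- ★ `conjAdele_baseChange_mul_delta`, `quadraticAdeleEquiv` re∕im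
import Summits.HodgeConjecture.HodgeConjecture.Theorems.K2LiuCornerTorusAction            -- ★ `baseChange_re_of_conjAdele_eq` (σ-invariant ⇒ base change of the real part)
import HarnessLib

/-!
# Crux `HLiu418`, KIND 1, (K1b-W) route: `σ x = x ⇒ x = (re x) ⊗ 1`, and the rescaled corner coordinate

Cell `hodgecm-mathlib`, crux item hLiu418 = `stmt-HodgeConjecture-24832` (helper lane, count-neutral); squad K2 ∕ K2Liu, LEAD F0P6-plan (g14); prover F0P2-p11 (g2).
THEOREMS ONLY (no `def`, no `instance`, no notation, no named-fact hypothesis, no `sorry`).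

★ p862924 `toBlocks₁₂_levi_conj_corner`: under Levi conjugation the corner coordinate `(t⊗1)δ` becomes `y · σ(y) · (t⊗1)δ` (`y = (g⁻¹)₁₁`).  The factor `x = y σ(y)` is
`σ`-invariant, hence a base change (★ `K2LiuCornerTorusAction.baseChange_re_of_conjAdele_eq`: `σ x = x ⇒ (re x) ⊗ 1 = x`, `re x := (Ψ_𝔸⁻¹ x).1`), and
**`norm_mul_corner_coordinate`** — `y σ(y) · ((t⊗1)δ) = ((re(y σ y) · t)⊗1)·δ`.  So the rescaled unipotent of ★ p862907∕p862924 may be taken to be ★ p861153's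
`n₂ (re(y σ y) · t)` (same corner coordinate ⇒ same value behind `w₀`, ★ p862866).
HONEST LABEL.  Count-neutral helper; `HC_CM` is proved only modulo the 7 printed citations (2 remaining named inputs: hLiu418 = `stmt-HodgeConjecture-24832`,
h413 = `stmt-HodgeConjecture-24833`) until rung 0 closes.

## References
* [CasselsFrohlichANT1967] J. W. S. Cassels, A. Fröhlich (eds.), *Algebraic Number Theory* (1967), Ch. II §10 (adeles of a quadratic extension).
* [KudlaRallis1994] S. Kudla, S. Rallis, Ann. of Math. 140 (1994), §2.
-/

set_option autoImplicit false
set_option linter.dupNamespace false -- the mandated namespace repeats `HodgeConjecture.HodgeConjecture`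

noncomputable section

open NumberField IsDedekindDomain
open Literature.NumberTheory.Automorphic Literature.NumberTheory.Automorphic.UnitaryGroup Literature.NumberTheory.GaloisRepresentations
open Literature.NumberTheory.GelbartRogawski1991 Literature.NumberTheory.GelbartRogawski1991.GRConstruction
open UnitaryDualPair

namespace Summit.HodgeConjecture.HodgeConjecture.Cruxes.HLiu418.K2LiuAdeleRealPartBaseChange

open K2LiuUnipDeltaCornerCoordinates K2LiuCornerTorusAction

variable (L : Type) [Field L] [NumberField L] [IsCMField L]

/-- a product `y · σ(y)` is `σ`-invariant. [folklore] -/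
theorem conjAdele_mul_conj_self (y : AdeleRing (𝓞 L) L) :
    conjAdele (Fp L) L (IsCMField.complexConj L) (y * conjAdele (Fp L) L (IsCMField.complexConj L) y) = y * conjAdele (Fp L) L (IsCMField.complexConj L) y := by
  rw [map_mul, conjAdele_conjAdele (hc := AlgEquiv.ext fun x => IsCMField.complexConj_apply_apply L x), mul_comm]

/-- **THE RESCALED CORNER COORDINATE IS ON THE CORNER LINE**: `y σ(y) · ((t⊗1)·δ) = ((re(y σ y) · t)⊗1)·δ` — so the norm-rescaled unipotent of ★ p862924 has the corner
coordinate of ★ p861153's `n₂ (re(y σ y) · t)`. [cite: CasselsFrohlichANT1967, Ch. II §10] [cite: KudlaRallis1994, §2] -/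
theorem norm_mul_corner_coordinate (y : AdeleRing (𝓞 L) L) (t : AdeleRing (𝓞 (Fp L)) (Fp L)) :
    y * conjAdele (Fp L) L (IsCMField.complexConj L) y * (AdeleRing.baseChange (Fp L) L t * algebraMap L (AdeleRing (𝓞 L) L) (imagUnit L)) =
      AdeleRing.baseChange (Fp L) L
          (((quadraticAdeleEquiv (Fp L) L (IsCMField.complexConj L) (complexConj_imagUnit L) (imagUnit_ne_zero L)).symm
              (y * conjAdele (Fp L) L (IsCMField.complexConj L) y)).1 * t) *
        algebraMap L (AdeleRing (𝓞 L) L) (imagUnit L) := by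
  rw [map_mul, baseChange_re_of_conjAdele_eq L (conjAdele_mul_conj_self L y)]
  ring

end Summit.HodgeConjecture.HodgeConjecture.Cruxes.HLiu418.K2LiuAdeleRealPartBaseChange

end
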